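import Literature.Computability.AlgebraicComplexity.Kron444HullCheck
import HarnessLib

/-!
# `Kron(4,4,4) ⊆ conv(328 vertices)`: certificate checks, part 14/14

Proofs file (computations only): the node checks of `Kron444HullCheck.lean` for the chunks
194 … 201 of the certificate, each decided by the kernel (`decide +kernel`; `maxHeartbeats 0`:
a chunk is ≈ 10⁵–10⁶ kernel reductions). Assembled in `Kron444Hull.lean`. [folklore]
-/

set_option Elab.async false

namespace Literature.Computability.AlgebraicComplexity.Kron444Hull

/-- Nodes `4850 … 4874` of the certificate (chunk `194`) pass `checkNodeRec`. [folklore] -/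
theorem checkChunk_194 : checkChunk 194 25 = true := by
  set_option maxHeartbeats 0 in decide +kernel

/-- Nodes `4875 … 4899` of the certificate (chunk `195`) pass `checkNodeRec`. [folklore] -/
theorem checkChunk_195 : checkChunk 195 25 = true := by
  set_option maxHeartbeats 0 in decide +kernel

/-- Nodes `4900 … 4924` of the certificate (chunk `196`) pass `checkNodeRec`. [folklore] -/
theorem checkChunk_196 : checkChunk 196 25 = true := by
  set_option maxHeartbeats 0 in decide +kernel

/-- Nodes `4925 … 4949` of the certificate (chunk `197`) pass `checkNodeRec`. [folklore] -/
theorem checkChunk_197 : checkChunk 197 25 = true := by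
  set_option maxHeartbeats 0 in decide +kernel

/-- Nodes `4950 … 4974` of the certificate (chunk `198`) pass `checkNodeRec`. [folklore] -/
theorem checkChunk_198 : checkChunk 198 25 = true := by
  set_option maxHeartbeats 0 in decide +kernel

/-- Nodes `4975 … 4999` of the certificate (chunk `199`) pass `checkNodeRec`. [folklore] -/
theorem checkChunk_199 : checkChunk 199 25 = true := by
  set_option maxHeartbeats 0 in decide +kernel

/-- Nodes `5000 … 5024` of the certificate (chunk `200`) pass `checkNodeRec`. [folklore] -/
theorem checkChunk_200 : checkChunk 200 25 = true := by
  set_option maxHeartbeats 0 in decide +kernel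

/-- Nodes `5025 … 5039` of the certificate (chunk `201`) pass `checkNodeRec`. [folklore] -/
theorem checkChunk_201 : checkChunk 201 15 = true := by
  set_option maxHeartbeats 0 in decide +kernel

end Literature.Computability.AlgebraicComplexity.Kron444Hull
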